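import Summits.QuantumFields.YangMills.Theorems.BalabanUVNodesN15KingModelBoxEvenSymbol
import Summits.QuantumFields.YangMills.Theorems.BalabanUVNodesN15KingModelBlockFieldNormalisationDensity
import Summits.QuantumFields.YangMills.Theorems.BalabanUVNodesN15KingModelFreeRGForms
import HarnessLib

/-!
# BalabanUVNodes ∕ N15 — THE KING-MODEL RUNG (PART Ϟ-j): THE RG BLOCK-FIELD FREE ENERGY DENSITY ON KING's REGION `Ω` WITH FREE BOUNDARY CONDITIONS —
# `| |T̂(2n)|⁻¹ln det Δ^{(K)}_{Πℤ∕2n_μ} − |Ω|⁻¹ln det Δ^{(K)}_Ω | ≤ 2B_Δ·Σ_μ1∕n_μ` AT FINITE VOLUME, AND `|Ω_j|⁻¹ln det Δ^{(K)}_{Ω_j} → bzMean(ln Δ^{(K)})` = THE PERIODIC LIMIT (part Ε-t);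
# hence `|Ω_j|⁻¹ln N_K(Ω_j) → ½ln 2π − ½bzMean(ln Δ^{(K)})`: KING's (3.89)–(3.93) NORMALISATIONS PER SITE AGREE ON `Ω` AND ON THE TORUS IN THE THERMODYNAMIC LIMIT
# (Track A, DAG node N15 = NE2; FAN-OUT v1.1 §N15 s3 «KING-MODEL RUNG»; King p.670 l.8–13 «free boundary conditions»; count-neutral)

HONEST FRAMING.  Count-neutral (cell `pub-ymgap`, seat `pub-ymgap-dag-n15-e` g41; `--supports stmt-QuantumFields-27366 --as helper` = K3⁸).
TEMPLATE LITERATURE: C. King, Commun. Math. Phys. **102** (1986) 649–677 [King1986]: (3.89)–(3.93) pp.668–669 (`ln N_k = −½ln det Δ^{(k)} + const`, extensive with volume-uniform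
per-site control), (4.5) p.670 (the alias symbol), §4 p.670 l.8–13 (on `Ω`: free boundary conditions).  Part Ε-t (g40) proved `|T|⁻¹ln det Δ^{(K)}_T → bzMean(ln Δ^{(K)})` along
ANY tori; part Ϟ-c gave `ln det Δ^{(K)}_Ω = Σ_{k∈Ω} ln effSym(k̂)`; part Ϟ-i the coordinatewise evenness of (4.5) (`Δ^{(K)}(p′(σ_S k̂)) = Δ^{(K)}(π(k+1_S)∕n)`) and the generic telescoping
bound for shifted half-grid sums.  THIS FILE assembles them: §1 `log_effSym_torReflS_dblBox`, ★★ **`sum_log_effSym_dblTorus_eq`** (`Σ_{q∈T̂(2n)} ln effSym(q) = Σ_{S⊆{0..d}}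
boxShiftSum (ln Δ^{(K)}) S` — the doubled torus's dual tiled by the shifted half grids, for the BLOCK-FIELD symbol), `sOf_dblBox_eq_boxShiftPt`, ★ `log_det_foldOp_effLaplacian_eq_boxShiftSum`
(`ln det Δ^{(K)}_Ω = boxShiftSum (ln Δ^{(K)}) ∅`); §2 `abs_log_DeltaEff_le_zone` (`|ln Δ^{(K)}(p)| ≤ B_Δ := |ln(a⁻¹+m⁻²)⁻¹| + |ln a|` on the closed zone); §3 ★★★
**`abs_log_det_effLaplacian_dbl_div_card_sub_box_le`** (FREE vs PERIODIC at finite volume for the RG block-field operator: `≤ 2B_Δ·Σ_μ1∕n_μ`), ★★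
`abs_log_gaussNorm_effLaplacian_dbl_div_card_sub_box_le` (the normalisations per site, constant `B_Δ`); §4 ★★★ **`tendsto_log_det_foldOp_effLaplacian_div_card`** (`|Ω_j|⁻¹ln det Δ^{(K)}_{Ω_j}
→ bzMean(ln Δ^{(K)})` along ANY boxes with all sides `→ ∞` — THE SAME LIMIT AS ON TORI), ★★★ **`tendsto_log_gaussNorm_foldOp_effLaplacian_div_card`** (`|Ω_j|⁻¹ln N_K(Ω_j) → ½ln 2π −
½bzMean(ln Δ^{(K)})`).

PRIOR TREE ART (named, USED not restated): Ϟ-i (`boxShiftSum`, `abs_boxShiftSum_sub_empty_le`, `DeltaEff_sOf_torReflS_dblBox`, `boxShiftPt_mem_zone`), Ϟ-g (`boxShiftPt`), Ϟ-c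
(`log_det_foldOp_effLaplacian`, `log_gaussNorm_foldOp_effLaplacian`), Ϟ-e (`card_kingBox`), Ν-b (`sum_dblTorus_eq_sum_images`, `card_dblTorus_eq`), Ε-n∕Ε-p (`log_det_effLaplacian`,
`log_gaussNorm_effLaplacian`), Ε-t (`tendsto_log_det_effLaplacian_div_card`), Ε-r (`bzMean`), `King1986` (`effSym_eq_DeltaEff`, `DeltaEff_le`), Τ-e∕Ϡ (`DeltaEff_ge_floor`).  NOT Bałaban's
covariant objects; NOT a node discharge (N15 is booked through n15-a's knit, untouched); nothing continuum-YM ∕ `ℝ⁴` ∕ OS ∕ Clay.  0 `sorry`; 0 `def`.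

HONEST SCOPE.  King's `A = 0` model, the RG block-field operator `Δ^{(K)} = effLaplacian N M a N² m²` with `N ≥ 1`, `a, m² > 0` (`c = N² = η⁻²`), on boxes of blocks
`Ω = Π_μ{0,…,n_μ−1}` and the doubled tori `Πℤ∕2n_μ`; the comparison torus is the DOUBLED one (where the images live).  The continuum (`K → ∞`) density limit on `Ω` follows by
combining with part Ε-u on the torus side and is not restated.  Locators: [King1986] (3.89)–(3.93) pp.668–669, (4.5) p.670, §4 p.670 l.8–13.
-/

noncomputable section

open scoped BigOperators Topology
open Finset Filter

namespace Summit.QuantumFields.YangMills.BalabanUVNodes.N15KingModelRung.TorusSpectral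

open Literature.MathematicalPhysics.QuantumFieldTheory.Balaban1983to89.B5Prop11Plancherel (Tor sOf)
open Literature.MathematicalPhysics.QuantumFieldTheory.King1986 (DeltaEff DeltaEff_le)
open Literature.MathematicalPhysics.QuantumFieldTheory.King1986.Torus
open Summit.QuantumFields.YangMills.BalabanUVNodes.N15KingModelRung.FreeField (gaussNorm DeltaEff_ge_floor)

variable {d : ℕ}

/-! ## §1 The doubled torus's dual tiled by the shifted half grids, for the block-field symbol -/

section Tiling

variable (N : ℕ) [NeZero N] (n : Fin (d + 1) → ℕ) [hn : ∀ μ, NeZero (n μ)] {a m2 : ℝ}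

/-- `ln effSym(σ_S k̂) = (ln Δ^{(K)})(boxShiftPt S k)` (`effSym = Δ^{(K)}∘p′` at `c = N²`, Ϟ-i's evenness). [cite: King1986, (4.5) p.670, §4 p.670] -/
theorem log_effSym_torReflS_dblBox (hN1 : 1 ≤ N) (ha : 0 < a) (hm : 0 < m2) (S : Finset (Fin (d + 1))) (k : KingBox n) :
    Real.log (effSym N (dblPer n) a ((N : ℝ) ^ 2) m2 (torReflS (dblPer n) S (dblBox n k))) = (fun p => Real.log (DeltaEff a N m2 p)) (boxShiftPt n S k) := by
  rw [effSym_eq_DeltaEff N (dblPer n) hN1 ha hm, DeltaEff_sOf_torReflS_dblBox]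

/-- ★★ **THE DUAL OF THE DOUBLED TORUS IS TILED BY THE SHIFTED HALF GRIDS (block-field symbol)**: `Σ_{q∈T̂(2n)} ln effSym(q) = Σ_{S⊆{0..d}} boxShiftSum (ln Δ^{(K)}) S` — EXACT.
[cite: King1986, (4.5) p.670, §4 p.670 l.8–13] -/
theorem sum_log_effSym_dblTorus_eq (hN1 : 1 ≤ N) (ha : 0 < a) (hm : 0 < m2) :
    ∑ q : Tor (dblPer n), Real.log (effSym N (dblPer n) a ((N : ℝ) ^ 2) m2 q)
      = ∑ S : Finset (Fin (d + 1)), boxShiftSum n (fun p => Real.log (DeltaEff a N m2 p)) S := by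
  rw [sum_dblTorus_eq_sum_images n (fun q => Real.log (effSym N (dblPer n) a ((N : ℝ) ^ 2) m2 q))]
  refine Finset.sum_congr rfl fun S _ => ?_
  unfold boxShiftSum
  exact Finset.sum_congr rfl fun k _ => log_effSym_torReflS_dblBox N n hN1 ha hm S k

omit hn in
/-- the unshifted half-grid point is the reduced momentum of `k̂`: `p′(k̂) = boxShiftPt ∅ k`. [cite: King1986, (4.1) p.670] -/
theorem sOf_dblBox_eq_boxShiftPt [∀ μ, NeZero (n μ)] (k : KingBox n) : sOf (dblPer n) (dblBox n k) = boxShiftPt n ∅ k := by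
  funext μ
  rw [sOf_dblBox]
  simp only [boxShiftPt, Finset.notMem_empty, if_false, add_zero]

/-- ★ `ln det Δ^{(K)}_Ω = boxShiftSum (ln Δ^{(K)}) ∅` (Ϟ-c's closed form through the symbol (4.5)). [cite: King1986, (3.89) p.668, (4.5) p.670, §4 p.670 l.8–13] -/
theorem log_det_foldOp_effLaplacian_eq_boxShiftSum (hN1 : 1 ≤ N) (ha : 0 < a) (hm : 0 < m2) :
    Real.log (foldOp n (effLaplacian N (dblPer n) a ((N : ℝ) ^ 2) m2)).det = boxShiftSum n (fun p => Real.log (DeltaEff a N m2 p)) ∅ := by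
  rw [log_det_foldOp_effLaplacian N n ha (by positivity) hm]
  unfold boxShiftSum
  refine Finset.sum_congr rfl fun k _ => ?_
  rw [effSym_eq_DeltaEff N (dblPer n) hN1 ha hm, sOf_dblBox_eq_boxShiftPt]

end Tiling

/-! ## §2 The block-field symbol is bounded on the closed zone -/

section Bound

variable (N : ℕ) {a m2 : ℝ}

/-- `|ln Δ^{(K)}(p)| ≤ B_Δ := |ln(a⁻¹+m⁻²)⁻¹| + |ln a|` for `p ∈ [0,π]^{d+1}` (floor `(a⁻¹+m⁻²)⁻¹ ≤ Δ^{(K)} ≤ a`). [cite: King1986, (4.5) p.670, (4.8) p.671] -/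
theorem abs_log_DeltaEff_le_zone (hN1 : 1 ≤ N) (ha : 0 < a) (hm : 0 < m2) (p : Fin (d + 1) → ℝ) (hp : ∀ ν, 0 ≤ p ν ∧ p ν ≤ Real.pi) :
    |Real.log (DeltaEff a N m2 p)| ≤ |Real.log ((a⁻¹ + m2⁻¹)⁻¹)| + |Real.log a| := by
  have hp' : ∀ μ, |p μ| ≤ Real.pi := fun μ => by rw [abs_of_nonneg (hp μ).1]; exact (hp μ).2
  have hlo : (a⁻¹ + m2⁻¹)⁻¹ ≤ DeltaEff a N m2 p := DeltaEff_ge_floor ha hm hN1 hp'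
  have hhi : DeltaEff a N m2 p ≤ a := DeltaEff_le ha N hm.le p
  have hflo : 0 < (a⁻¹ + m2⁻¹)⁻¹ := by positivity
  have hpos : 0 < DeltaEff a N m2 p := lt_of_lt_of_le hflo hlo
  have h1 : Real.log ((a⁻¹ + m2⁻¹)⁻¹) ≤ Real.log (DeltaEff a N m2 p) := Real.log_le_log hflo hlo
  have h2 : Real.log (DeltaEff a N m2 p) ≤ Real.log a := Real.log_le_log hpos hhi
  rw [abs_le]
  constructor
  · linarith [neg_abs_le (Real.log ((a⁻¹ + m2⁻¹)⁻¹)), abs_nonneg (Real.log a)]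
  · linarith [le_abs_self (Real.log a), abs_nonneg (Real.log ((a⁻¹ + m2⁻¹)⁻¹))]

end Bound

/-! ## §3 Free versus periodic boundary conditions at finite volume, for the RG block-field operator -/

section Comparison

variable (N : ℕ) [NeZero N] (n : Fin (d + 1) → ℕ) [hn : ∀ μ, NeZero (n μ)] {a m2 : ℝ}

/-- ★★★ **FREE vs PERIODIC BOUNDARY CONDITIONS FOR `Δ^{(K)}` AT FINITE VOLUME**: for `N ≥ 1`, `a, m² > 0` and every box `Ω` of blocks,
`| |T̂(2n)|⁻¹·ln det Δ^{(K)}_{Πℤ∕2n_μ} − |Ω|⁻¹·ln det Δ^{(K)}_Ω | ≤ 2(|ln(a⁻¹+m⁻²)⁻¹| + |ln a|)·Σ_μ(n_μ)⁻¹` — a surface-to-volume rate. [cite: King1986, (3.89)–(3.93) pp.668–669,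
(4.5) p.670, §4 p.670 l.8–13] -/
theorem abs_log_det_effLaplacian_dbl_div_card_sub_box_le (hN1 : 1 ≤ N) (ha : 0 < a) (hm : 0 < m2) :
    |(Fintype.card (Tor (dblPer n)) : ℝ)⁻¹ * Real.log (effLaplacian N (dblPer n) a ((N : ℝ) ^ 2) m2).det
        - (Fintype.card (KingBox n) : ℝ)⁻¹ * Real.log (foldOp n (effLaplacian N (dblPer n) a ((N : ℝ) ^ 2) m2)).det|
      ≤ 2 * (|Real.log ((a⁻¹ + m2⁻¹)⁻¹)| + |Real.log a|) * ∑ μ, ((n μ : ℝ))⁻¹ := by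
  set B : ℝ := |Real.log ((a⁻¹ + m2⁻¹)⁻¹)| + |Real.log a| with hB
  set h : (Fin (d + 1) → ℝ) → ℝ := fun p => Real.log (DeltaEff a N m2 p) with hh
  have hB0 : 0 ≤ B := by positivity
  have hBh : ∀ p : Fin (d + 1) → ℝ, (∀ ν, 0 ≤ p ν ∧ p ν ≤ Real.pi) → |h p| ≤ B := fun p hp => abs_log_DeltaEff_le_zone N hN1 ha hm p hp
  have hP : (0 : ℝ) < ∏ ν, (n ν : ℝ) := Finset.prod_pos fun ν _ => by exact_mod_cast NeZero.pos (n ν)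
  have h2 : (0 : ℝ) < 2 ^ (d + 1) := by positivity
  have hT : (Fintype.card (Tor (dblPer n)) : ℝ)⁻¹ * Real.log (effLaplacian N (dblPer n) a ((N : ℝ) ^ 2) m2).det
      = ((2 : ℝ) ^ (d + 1))⁻¹ * (∏ ν, (n ν : ℝ))⁻¹ * ∑ S : Finset (Fin (d + 1)), boxShiftSum n h S := by
    rw [log_det_effLaplacian N (dblPer n) ha (by positivity) hm, sum_log_effSym_dblTorus_eq N n hN1 ha hm, card_dblTorus_eq n, card_kingBox n]
    push_cast
    rw [mul_inv]
  have hΩ : (Fintype.card (KingBox n) : ℝ)⁻¹ * Real.log (foldOp n (effLaplacian N (dblPer n) a ((N : ℝ) ^ 2) m2)).det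
      = ((2 : ℝ) ^ (d + 1))⁻¹ * (∏ ν, (n ν : ℝ))⁻¹ * ∑ _S : Finset (Fin (d + 1)), boxShiftSum n h ∅ := by
    rw [log_det_foldOp_effLaplacian_eq_boxShiftSum N n hN1 ha hm, card_kingBox n, Finset.sum_const, Finset.card_univ, Fintype.card_finset, Fintype.card_fin, nsmul_eq_mul]
    push_cast
    rw [mul_mul_mul_comm, inv_mul_cancel₀ h2.ne', one_mul]
  rw [hT, hΩ, ← mul_sub, ← Finset.sum_sub_distrib, abs_mul, abs_of_pos (by positivity : (0 : ℝ) < ((2 : ℝ) ^ (d + 1))⁻¹ * (∏ ν, (n ν : ℝ))⁻¹)]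
  have hsum : |∑ S : Finset (Fin (d + 1)), (boxShiftSum n h S - boxShiftSum n h ∅)| ≤ ∑ _S : Finset (Fin (d + 1)), 2 * B * (∏ ν, (n ν : ℝ)) * ∑ μ, ((n μ : ℝ))⁻¹ := by
    refine (Finset.abs_sum_le_sum_abs _ _).trans (Finset.sum_le_sum fun S _ => ?_)
    refine (abs_boxShiftSum_sub_empty_le n h hBh S).trans ?_
    refine mul_le_mul_of_nonneg_left ?_ (by positivity)
    exact Finset.sum_le_univ_sum_of_nonneg fun μ => by positivity
  rw [Finset.sum_const, Finset.card_univ, Fintype.card_finset, Fintype.card_fin, nsmul_eq_mul] at hsum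
  push_cast at hsum
  calc ((2 : ℝ) ^ (d + 1))⁻¹ * (∏ ν, (n ν : ℝ))⁻¹ * |∑ S : Finset (Fin (d + 1)), (boxShiftSum n h S - boxShiftSum n h ∅)|
      ≤ ((2 : ℝ) ^ (d + 1))⁻¹ * (∏ ν, (n ν : ℝ))⁻¹ * (2 ^ (d + 1) * (2 * B * (∏ ν, (n ν : ℝ)) * ∑ μ, ((n μ : ℝ))⁻¹)) :=
        mul_le_mul_of_nonneg_left hsum (by positivity)
    _ = 2 * B * ∑ μ, ((n μ : ℝ))⁻¹ := by field_simp

/-- ★★ **THE SAME FOR KING's NORMALISATIONS PER SITE**: `| |T̂(2n)|⁻¹ln N_K(Πℤ∕2n) − |Ω|⁻¹ln N_K(Ω) | ≤ (|ln(a⁻¹+m⁻²)⁻¹| + |ln a|)·Σ_μ(n_μ)⁻¹`. [cite: King1986, (3.89)–(3.93) pp.668–669, §4 p.670] -/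
theorem abs_log_gaussNorm_effLaplacian_dbl_div_card_sub_box_le (hN1 : 1 ≤ N) (ha : 0 < a) (hm : 0 < m2) :
    |(Fintype.card (Tor (dblPer n)) : ℝ)⁻¹ * Real.log (gaussNorm (effLaplacian N (dblPer n) a ((N : ℝ) ^ 2) m2))
        - (Fintype.card (KingBox n) : ℝ)⁻¹ * Real.log (gaussNorm (foldOp n (effLaplacian N (dblPer n) a ((N : ℝ) ^ 2) m2)))|
      ≤ (|Real.log ((a⁻¹ + m2⁻¹)⁻¹)| + |Real.log a|) * ∑ μ, ((n μ : ℝ))⁻¹ := by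
  have hT0 : (Fintype.card (Tor (dblPer n)) : ℝ) ≠ 0 := by exact_mod_cast Fintype.card_ne_zero
  have hΩ0 : (Fintype.card (KingBox n) : ℝ) ≠ 0 := by exact_mod_cast Fintype.card_ne_zero
  have h := abs_log_det_effLaplacian_dbl_div_card_sub_box_le N n hN1 ha hm
  rw [log_gaussNorm_effLaplacian N (dblPer n) ha (by positivity) hm, log_gaussNorm_foldOp_effLaplacian N n ha (by positivity) hm,
    ← log_det_effLaplacian N (dblPer n) ha (by positivity) hm, ← log_det_foldOp_effLaplacian N n ha (by positivity) hm]
  have e : (Fintype.card (Tor (dblPer n)) : ℝ)⁻¹ * ((Fintype.card (Tor (dblPer n)) : ℝ) / 2 * Real.log (2 * Real.pi) - 1 / 2 * Real.log (effLaplacian N (dblPer n) a ((N : ℝ) ^ 2) m2).det)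
      - (Fintype.card (KingBox n) : ℝ)⁻¹ * ((Fintype.card (KingBox n) : ℝ) / 2 * Real.log (2 * Real.pi) - 1 / 2 * Real.log (foldOp n (effLaplacian N (dblPer n) a ((N : ℝ) ^ 2) m2)).det)
      = -(1 / 2) * ((Fintype.card (Tor (dblPer n)) : ℝ)⁻¹ * Real.log (effLaplacian N (dblPer n) a ((N : ℝ) ^ 2) m2).det
          - (Fintype.card (KingBox n) : ℝ)⁻¹ * Real.log (foldOp n (effLaplacian N (dblPer n) a ((N : ℝ) ^ 2) m2)).det) := by
    field_simp
    ring
  rw [e, abs_mul, abs_neg, abs_of_pos (by norm_num : (0 : ℝ) < 1 / 2)]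
  calc _ ≤ 1 / 2 * (2 * (|Real.log ((a⁻¹ + m2⁻¹)⁻¹)| + |Real.log a|) * ∑ μ, ((n μ : ℝ))⁻¹) := mul_le_mul_of_nonneg_left h (by norm_num)
    _ = _ := by ring

end Comparison

/-! ## §4 The thermodynamic limit with free boundary conditions equals the periodic one -/

section Limit

variable (N : ℕ) [NeZero N] {a m2 : ℝ}

/-- ★★★ **THE RG BLOCK-FIELD FREE ENERGY DENSITY WITH FREE BOUNDARY CONDITIONS CONVERGES TO THE PERIODIC LIMIT**: along ANY boxes `Ω_j = Π_μ{0,…,n_{j,μ}−1}` of blocks with every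
`n_{j,μ} → ∞`, for `N ≥ 1`, `a, m² > 0`: `|Ω_j|⁻¹·ln det Δ^{(K)}_{Ω_j} → bzMean(ln Δ^{(K)}) = (2π)^{−(d+1)}∫_{(−π,π]^{d+1}}ln Δ^{(K)}(p′)dp′` (part Ε-t's torus limit).
[cite: King1986, (3.89)–(3.93) pp.668–669, (4.5) p.670, §4 p.670 l.8–13] -/
theorem tendsto_log_det_foldOp_effLaplacian_div_card (hN1 : 1 ≤ N) (ha : 0 < a) (hm : 0 < m2) (nseq : ℕ → Fin (d + 1) → ℕ) (hpos : ∀ j ν, 0 < nseq j ν)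
    (hlim : ∀ ν, Tendsto (fun j => (nseq j ν : ℝ)) atTop atTop) :
    Tendsto (fun j => haveI : ∀ ν, NeZero (nseq j ν) := fun ν => ⟨(hpos j ν).ne'⟩
      (Fintype.card (KingBox (nseq j)) : ℝ)⁻¹ * Real.log (foldOp (nseq j) (effLaplacian N (dblPer (nseq j)) a ((N : ℝ) ^ 2) m2)).det) atTop
      (𝓝 (bzMean (fun p : Fin (d + 1) → ℝ => Real.log (DeltaEff a N m2 p)) d)) := by
  -- the torus densities of the doubled tori converge (Ε-t)
  have hT := tendsto_log_det_effLaplacian_div_card (d := d) N hN1 ha hm (fun j => dblPer (nseq j))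
    (fun j ν => by simp only [dblPer]; exact Nat.mul_pos two_pos (hpos j ν))
    (fun ν => by
      have : Tendsto (fun j => (2 : ℝ) * (nseq j ν : ℝ)) atTop atTop := (hlim ν).const_mul_atTop two_pos
      refine this.congr fun j => ?_
      simp only [dblPer]; push_cast; ring)
  -- the difference tends to zero by the surface-to-volume rate
  have hrate : Tendsto (fun j => 2 * (|Real.log ((a⁻¹ + m2⁻¹)⁻¹)| + |Real.log a|) * ∑ μ, ((nseq j μ : ℝ))⁻¹) atTop (𝓝 0) := by
    have h0 : Tendsto (fun j => ∑ μ, ((nseq j μ : ℝ))⁻¹) atTop (𝓝 0) := by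
      have := tendsto_finsetSum (Finset.univ : Finset (Fin (d + 1))) fun μ _ => (hlim μ).inv_tendsto_atTop
      simpa using this
    simpa using h0.const_mul (2 * (|Real.log ((a⁻¹ + m2⁻¹)⁻¹)| + |Real.log a|))
  have hdiff : Tendsto (fun j => haveI : ∀ ν, NeZero (nseq j ν) := fun ν => ⟨(hpos j ν).ne'⟩
      (Fintype.card (Tor (dblPer (nseq j))) : ℝ)⁻¹ * Real.log (effLaplacian N (dblPer (nseq j)) a ((N : ℝ) ^ 2) m2).det
        - (Fintype.card (KingBox (nseq j)) : ℝ)⁻¹ * Real.log (foldOp (nseq j) (effLaplacian N (dblPer (nseq j)) a ((N : ℝ) ^ 2) m2)).det) atTop (𝓝 0) := by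
    refine squeeze_zero_norm (fun j => ?_) hrate
    haveI : ∀ ν, NeZero (nseq j ν) := fun ν => ⟨(hpos j ν).ne'⟩
    rw [Real.norm_eq_abs]
    exact abs_log_det_effLaplacian_dbl_div_card_sub_box_le N (nseq j) hN1 ha hm
  have h := hT.sub hdiff
  rw [sub_zero] at h
  refine h.congr fun j => ?_
  ring

/-- ★★★ **KING's NORMALISATION PER SITE ON `Ω` IN THE THERMODYNAMIC LIMIT**: `|Ω_j|⁻¹·ln N_K(Ω_j) → ½ln 2π − ½·bzMean(ln Δ^{(K)})` — the same limit as on the tori (Ε-t).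
[cite: King1986, (3.89)–(3.93) pp.668–669, (2.6) p.652, §4 p.670 l.8–13] -/
theorem tendsto_log_gaussNorm_foldOp_effLaplacian_div_card (hN1 : 1 ≤ N) (ha : 0 < a) (hm : 0 < m2) (nseq : ℕ → Fin (d + 1) → ℕ) (hpos : ∀ j ν, 0 < nseq j ν)
    (hlim : ∀ ν, Tendsto (fun j => (nseq j ν : ℝ)) atTop atTop) :
    Tendsto (fun j => haveI : ∀ ν, NeZero (nseq j ν) := fun ν => ⟨(hpos j ν).ne'⟩
      (Fintype.card (KingBox (nseq j)) : ℝ)⁻¹ * Real.log (gaussNorm (foldOp (nseq j) (effLaplacian N (dblPer (nseq j)) a ((N : ℝ) ^ 2) m2)))) atTop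
      (𝓝 (1 / 2 * Real.log (2 * Real.pi) - 1 / 2 * bzMean (fun p : Fin (d + 1) → ℝ => Real.log (DeltaEff a N m2 p)) d)) := by
  have h := tendsto_log_det_foldOp_effLaplacian_div_card N hN1 ha hm nseq hpos hlim
  have h' := (tendsto_const_nhds (x := 1 / 2 * Real.log (2 * Real.pi))).sub (h.const_mul (1 / 2))
  refine h'.congr fun j => ?_
  haveI : ∀ ν, NeZero (nseq j ν) := fun ν => ⟨(hpos j ν).ne'⟩
  have hcard : (Fintype.card (KingBox (nseq j)) : ℝ) ≠ 0 := by exact_mod_cast Fintype.card_ne_zero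
  rw [log_gaussNorm_foldOp_effLaplacian N (nseq j) ha (by positivity) hm, ← log_det_foldOp_effLaplacian N (nseq j) ha (by positivity) hm, mul_sub,
    show ((Fintype.card (KingBox (nseq j)) : ℝ))⁻¹ * ((Fintype.card (KingBox (nseq j)) : ℝ) / 2 * Real.log (2 * Real.pi)) = 1 / 2 * Real.log (2 * Real.pi) by
      rw [div_eq_mul_inv, ← mul_assoc, ← mul_assoc, inv_mul_cancel₀ hcard, one_mul]; ring]
  ring

end Limit

end Summit.QuantumFields.YangMills.BalabanUVNodes.N15KingModelRung.TorusSpectral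

end
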